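import Summits.QuantumFields.YangMills.Theorems.BalabanUVNodesK1WindowKOfRunRowsSurvivors
import Summits.QuantumFields.YangMills.Theorems.BalabanUVNodesK1NodeOLadderRunwiseEdges

/-!
# Crux K1⁷ ∕ K1⁸ — THE END FROM RUN ROWS WITH ROW (iv) ONE RUNG LOWER: rows (i) `RunConstRemainder` + run-wise NO-(1+β₀)⁻¹-SHRINK + (C) `SurvCont` ⟹ `EndpointExistence`,
# through a PER-LEVEL top-run END road (Gaps' `endpointExistence_of_topRunsGstar` with the uniform ceiling removed); the road of record (rows (i)+(iv)+(C)) factors through it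

Cell `pub-ymgap`, YM-PLAN Track A (HUMAN RULING D-0062 ∕ D-0149, director-ym №197 ∕ №207), WIDTH SEAT `pub-ymgap-dag-n13-w4` (g6) on NODE n13 [Balaban1989LargeFieldII]; helper
(`--supports stmt-QuantumFields-26907 --as helper`, count-neutral) for the deciding crux K1⁸ `StabilityBRunRowsAtRecordR13SepCoPH` = stmt-QuantumFields-26907 (route rev 26ᴿ ∕ 27,
plan g84; successor of K1⁷ `StabilityBAtRecordR13SepCoPH` = stmt-QuantumFields-20542, now `aside`), whose born-closed partner K2⁸ `EndpointGivenRunRowsR13SepCoPH` = stmt-QuantumFields-26908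
reads exactly this seat's g5 road `…K1WindowKOfRunRowsSurvivors.endpointExistence_datumOfRecord₁₃SepCoPH_of_runRows_survCont` (closer b2b-an4 `…K2R8Holds`).  Tenth module of the seat's
window ∕ survivor ∕ END lineage.

AUTHORSHIP ∕ ATTRIBUTION.  The mathematics and the Lean text of §1–§3 are ym-nodeO-ideate seat P3 «weaken the target» g53's evidence n°92 `Rev26RNoShrink-P3g53.lean`
(HOME `run/shared/lean/pub/ym-nodeO-ideate/memos/lines/`, sha256 610365a6808bd8b0…, farm-clean, attached as evidence on stmt-QuantumFields-20542 ∕ 20543; a planner seat files nothing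
under `Theorems/` — «provers may port»), themselves a thin layer over the TREE's Gaps END roads (`Gaps.EndUpperPerLevel` truncation, `Gaps.EndRunwiseShooting` shooting, `Gaps.EndSurvivorExtension`
Tietze table, `Gaps.EndContAlongFoliation` transfer; pub-balaban-gaps g1-p3 ∕ g1-plan-2) and over dag-n24-w1 g3's ladder edge `K1NodeOLadderRunwiseEdges.exists_noShrink_of_psFloor`.  This seat's
part: the port as a TREE module (P3's predicate shapes `RunwiseMulFloor` ∕ `TopRunsAt` UNFOLDED to their verbatim bodies, as dag-n24-w1 did for n°89; §4's inline concluder; header; kernel re-check).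
P3's §4–§5 (item texts `RunRowsNoShrink13` ∕ `K1R8NS`, the glue `closes26R_NS`, supply lemmas) are route ∕ plan business (R-30 reserve dial) and are NOT ported.

THE POINT.  K2⁸'s END road of record reads, floor-side, the RUN-WISE PARTIAL-SUM FLOOR `−M ≤ Σ_{j∈[k,n)} β_j` (row (iv) of K1 v6's stub 2″ ∕ of the pressed K1⁸ rows conjunct) — and uses it
ONLY through dag-n24-w1's edge «PS floor ⟹ no-(1+β₀)⁻¹-shrink on a shrunk level» ([Balaban1988Convergent] (2.6), last member, along the in-window (0.20)-runs).  Here the END is derived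
from the NO-SHRINK letter itself (any slack `β₀ ≥ 0`, any sub-level `0 < γ′ ≤ γ₀`), rows (i) and (C) unchanged: no-shrink ⟹ at every level `γ ≤ γ′` the top-run threshold `γ∕(1+β₀)` (§1),
and a NEW per-level twin of Gaps' `EndRunwiseHeadline.endpointExistence_of_topRunsGstar` (§2: forward generation + (C) + PER-LEVEL upper bounds `∀ k ∃ B_k` + per-level thresholds ⟹ END;
the uniform ceiling `β′` is gone — row (i) supplies only per-level survivor bounds `b_k + r`).  So the floor-side letter the END actually consumes is (2.6)'s last member, one rung BELOW (PS)
(strictly: `K1NodeOLadderRunwiseSeparations.absBox_noHalving_not_psFloor`); the road of record factors through the rung (`…_via_noShrink`).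

WHAT THIS FILE PROVES (theorems only; 0 `def`, 0 `sorry`, standard axioms; generic `β : HBeta` unless said).
* §1 `topRuns_of_noShrink` (no-shrink on `]0, γ_R]`, `0 ≤ β₀` ⟹ top-run threshold `γ∕(1+β₀)` at every level `γ ≤ γ_R`).
* §2 (any forward-generated `C : B12.Construction`): ★ `endpointExistence_of_topRunsGstar_locUpper` · `endpointExistence_of_topRunsGstar_uniform` (sanity) ·
  ★ `endpointExistence_of_cont_locUpper_noShrink` · ★ `endpointExistence_of_survivorLetters_locUpper_noShrink` · ★★ `endpointExistence_of_runConstRemainder_noShrink_survCont`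
  (rows (i) + NO-SHRINK + (C) ⟹ END) · `…_oneLevel` · `endpointExistence_of_runConstRemainder_runwisePS_survCont_via_noShrink` (the road of record through the rung) · `…_roadOfRecord` (g5's, by name).
* §3 (NODE 00's Stage-13 datum, general `N`): ★★ `endpointExistence_datumOfRecord₁₃SepCoPH_of_runConstRemainder_noShrink_survCont` · `endpointExistence_datumOfRecord₁₃SepCoPH_of_box_cont_noShrink`.
* §4 (`N = 2`, texts INLINE): ★ `endpointExistence_datumOfRecord₁₃SepCoPH_of_runRowsNoShrink` — K2⁸'s shape with the rows conjunct's row (iv) replaced by the no-shrink letter holds outright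
  (unity, admissibility, (B), window unread — as in K2⁸'s closer).

HONEST SCOPE.  Reductions between displayed HYPOTHESIS SHAPES over the tree's carriers; row (i), the no-shrink letter, (C) and every β-side statement are hypotheses inhabited at NO θ here
(NODE O: [I] Thm 2 p. 259 ∕ Thm 3 p. 264 ∕ (5.10) p. 293, (2.6) of [III]; continuity in the coupling asserted in [I] §1 pp. 263–264 without located proof); nothing of Bałaban asserted;
nothing about `Node00.betaOfRecord₁₃` proved; NOT a proof of `stub_runRows13PWS`, `stub_nodes13PWS`, `stub_cont13` or any K2 stub; K1⁷ ∕ K1⁸ ∕ K2⁷ NOT closed (K2⁸ is born closed by its own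
one-line closer, not by this file); N13 NOT discharged; counts unmoved (typed 28∕28 · discharged 5∕27 · A 5∕28).  One finite four-torus programme at fixed `ε = L^{−K}`, Bałaban AS PRINTED;
the Yang–Mills mass gap (Clay) is NOT proved by any of this — route R4 closes the conditional finite-𝕋⁴ rung `BalabanLadder.UV` only; nothing continuum ∕ ℝ⁴ ∕ OS.
No `def`, no `instance`, no `notation`, no `axiom`.
References (context only): [I] = [Balaban1987RG1] CMP **109** (1987): (0.17)–(0.20) pp. 255–256, Thm 2 p. 259, §1 pp. 263–264, (1.20)–(1.22) + Thm 3 p. 264, (5.10) p. 293;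
[III] = [Balaban1988Convergent] CMP **119** (1988): (2.6) p. 255; [V] = [Balaban1989LargeFieldII] CMP **122** (1989): Thm 1 + (0.1) pp. 355–356.
-/

noncomputable section

open scoped BigOperators Matrix.Norms.L2Operator

namespace Summit.QuantumFields.YangMills.Theorems.BalabanUVNodesK1EndOfRunRowsNoShrinkSurvCont

open Literature.MathematicalPhysics.QuantumFieldTheory.Balaban1983to89
open Literature.MathematicalPhysics.QuantumFieldTheory.Balaban1983to89.FlowStep (HBeta RGEqH prefixOf BetaContH BetaUpperH BetaLowerH Box mem_box box_mono Y
  clampPrefix inv_sq_telescopeH)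
open Literature.MathematicalPhysics.QuantumFieldTheory.Balaban1983to89.FlowStepRuns (modelOf modelOf_forwardGenerated modelOf_haltsOutside modelOf_curries flow_eq_of_rgEqH)
open Literature.MathematicalPhysics.QuantumFieldTheory.Balaban1983to89.DagBinding (EndpointExistence ForwardGenerated)
open Literature.MathematicalPhysics.QuantumFieldTheory.Balaban1983to89.T4Continuum (T4Family)
open Summit.QuantumFields.BalabanUV.Gaps.EndRunwiseShooting (couplingTrajectory_exists_of_topRuns)
open Summit.QuantumFields.BalabanUV.Gaps.EndUpperPerLevel (truncH betaContH_truncH betaUpperH_truncH rgEqH_of_truncH topRuns_truncH perLevelUpper_mono perLevelUpper_of_betaUpperH)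
open Summit.QuantumFields.BalabanUV.Gaps.EndSurvivorExtension (extH betaContH_extH perLevelUpper_extH rgEqH_of_rgEqH_extH exists_extension_of_survivorLetters)
open Summit.QuantumFields.BalabanUV.Gaps.EndContAlongFoliation (endpointExistence_of_runs)
open Summit.QuantumFields.BalabanUV.Gaps.EndSurvivorCensus (survCont_of_betaContH)
open Summit.QuantumFields.YangMills.Theorems.BalabanUVNodesK2NamedJetsRunRemAt (Survivors SurvCont RunConstRemainder survUpper_of_runConstRemainder)
open Summit.QuantumFields.YangMills.Theorems.BalabanUVNodesK1WindowKOfRunRowsSurvivors (endpointExistence_of_runConstRemainder_runwisePS_survCont)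
open Summit.QuantumFields.YangMills.BalabanUVNodes.K1RunRowsOfBoxAndPartialSums (runConstRemainder_of_boxBounds)
open Summit.QuantumFields.YangMills.Theorems.K1NodeOLadderRunwiseEdges (exists_noShrink_of_psFloor)
open Summit.QuantumFields.YangMills.Theorems.K1V6Defs (Window)

/-! ## §1 No-shrink ⟹ linear top-run thresholds (P3 n°91 ∕ n°92 §1, shapes unfolded) -/

section Shapes

variable {β : HBeta}

/-- **NO-(1+β₀)⁻¹-SHRINK ⟹ LINEAR TOP RUNS** (`0 ≤ β₀`): if along every (0.20)-run staying in `]0, γ_R]` one has `g_m ≤ (1+β₀)·g_{n′}` for `m < n′ ≤ n` ([Balaban1988Convergent] (2.6), last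
member), then at every level `0 < γ ≤ γ_R` a run in `]0, γ]` sitting AT `γ` at some step `k ≤ n` ends at `g_n ≥ γ∕(1+β₀)` (Gaps' top-run threshold `g⋆(γ) = γ∕(1+β₀)`).
P3 n°92 `linearTopRuns_of_runwiseMulFloor`, ported with the shapes unfolded. [cite: Balaban1988Convergent, (2.6) p.255; Balaban1987RG1, Thm 2 p.259 (first sentence), (0.20) p.256] -/
theorem topRuns_of_noShrink {β₀ γR : ℝ} (hβ₀ : 0 ≤ β₀)
    (h : ∀ (n : ℕ) (gs : ℕ → ℝ), RGEqH n β gs → Step.InInterval γR n gs → ∀ m n', m < n' → n' ≤ n → gs m ≤ (1 + β₀) * gs n') :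
    ∀ γ : ℝ, 0 < γ → γ ≤ γR →
      ∀ (n : ℕ) (gs : ℕ → ℝ), RGEqH n β gs → Step.InInterval γ n gs → ∀ k, k ≤ n → gs k = γ → γ / (1 + β₀) ≤ gs n := by
  intro γ hγ hγle n gs hrg hI k hk hgk
  have h1 : (0 : ℝ) < 1 + β₀ := by linarith
  rcases lt_or_eq_of_le hk with hlt | rfl
  · have hmul : gs k ≤ (1 + β₀) * gs n := h n gs hrg (fun i hi => ⟨(hI i hi).1, (hI i hi).2.trans hγle⟩) k n hlt le_rfl
    have h2 : γ ≤ gs n * (1 + β₀) := by rw [mul_comm, ← hgk]; exact hmul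
    exact (div_le_iff₀ h1).2 h2
  · rw [hgk]
    exact div_le_self hγ.le (by linarith)

end Shapes

/-! ## §2 END at construction level: per-level top-run thresholds WITH PER-LEVEL UPPER BOUNDS; hence (C) + per-level (U) + NO-SHRINK ⟹ END; survivor ∕ run-rows editions -/

section Construction

variable {C : B12.Construction} {β : HBeta}

/-- **★ `DagBinding.EndpointExistence` FROM FORWARD GENERATION + (C) + PER-LEVEL UPPER BOUNDS + PER-LEVEL TOP-RUN THRESHOLDS** — Gaps' `EndRunwiseHeadline.endpointExistence_of_topRunsGstar`
with the uniform (U) `BetaUpperH β′ γ₀ β` REPLACED by «`∀ k, ∃ B_k, β_k ≤ B_k` on `Box γ₀ k`» (the survivor currency's per-level bounds `b_k + r`).  Proof = Gaps' truncation pattern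
(`EndSurvivorExtension.endpointExistence_of_runwisePS_locUpper`): at level `γ` take `g⋆ := min g⋆(γ) γ` and `M_γ := 1∕g⋆² − 1∕γ² ≥ 0`; at each horizon `K` the truncation `truncH β K`
has (C), a UNIFORM ceiling (`betaUpperH_truncH`) and the top-run threshold (`topRuns_truncH`), hence by telescoping the `M_γ`-form that `EndRunwiseShooting.couplingTrajectory_exists_of_topRuns`
consumes; a `truncH β K`-run up to `K` is a `β`-run (`rgEqH_of_truncH`); forward uniqueness (`FlowStepRuns.flow_eq_of_rgEqH`).  NO non-crossing, NO sign, NO (PS).  P3 n°92 §2, ported verbatim.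
[cite: Balaban1987RG1, Thm 2 p.259 (first sentence), (0.20) p.256] -/
theorem endpointExistence_of_topRunsGstar_locUpper (hgen : ForwardGenerated C β) {γ₀ : ℝ} (hγ₀ : 0 < γ₀) (hcont : BetaContH γ₀ β)
    (hloc : ∀ k : ℕ, ∃ B : ℝ, ∀ v : Fin (k + 1) → ℝ, v ∈ Box γ₀ k → β k v ≤ B)
    (htop : ∀ γ : ℝ, 0 < γ → γ ≤ γ₀ → ∃ gstar : ℝ, 0 < gstar ∧
      ∀ (n : ℕ) (gs : ℕ → ℝ), RGEqH n β gs → Step.InInterval γ n gs → ∀ k, k ≤ n → gs k = γ → gstar ≤ gs n) :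
    EndpointExistence C := by
  intro m
  refine ⟨γ₀, hγ₀, fun γ hγ hγle => ?_⟩
  obtain ⟨gstar, hgstar, htopγ⟩ := htop γ hγ hγle
  have hmpos : 0 < min gstar γ := lt_min hgstar hγ
  have hM : 0 ≤ 1 / (min gstar γ) ^ 2 - 1 / γ ^ 2 := by
    have := one_div_le_one_div_of_le (pow_pos hmpos 2) (pow_le_pow_left₀ hmpos.le (min_le_right _ _) 2)
    linarith
  refine ⟨min gstar γ, hmpos, fun g hg hgle K => ?_⟩
  have hgM : 1 / γ ^ 2 + (1 / (min gstar γ) ^ 2 - 1 / γ ^ 2) ≤ 1 / g ^ 2 := by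
    have : 1 / (min gstar γ) ^ 2 ≤ 1 / g ^ 2 := one_div_le_one_div_of_le (pow_pos hg 2) (pow_le_pow_left₀ hg.le hgle 2)
    linarith
  have hcont' : BetaContH γ (truncH β K) := fun k => (betaContH_truncH hcont K k).mono (box_mono hγle k)
  obtain ⟨β', hβ', hhi⟩ := betaUpperH_truncH (perLevelUpper_mono hγle hloc) K
  -- the top-run threshold `min g⋆ γ ≤ γ` transfers to the truncation; telescoping turns it into the `M_γ`-form
  have htopK := topRuns_truncH K (min_le_right gstar γ) (fun n gs hrg hI k hk hgk => (min_le_left _ _).trans (htopγ n gs hrg hI k hk hgk))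
  have htopM : ∀ (n : ℕ) (gs : ℕ → ℝ), RGEqH n (truncH β K) gs → Step.InInterval γ n gs →
      ∀ k, k ≤ n → gs k = γ → -(1 / (min gstar γ) ^ 2 - 1 / γ ^ 2) ≤ ∑ j ∈ Finset.Ico k n, truncH β K j (prefixOf gs j) := by
    intro n gs hrg hI k hk hgk
    have hend : min gstar γ ≤ gs n := htopK n gs hrg hI k hk hgk
    have ht := inv_sq_telescopeH hrg hk le_rfl
    have h1 : 1 / (gs n) ^ 2 ≤ 1 / (min gstar γ) ^ 2 := one_div_le_one_div_of_le (pow_pos hmpos 2) (pow_le_pow_left₀ hmpos.le hend 2)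
    have h2 : 1 / (gs k) ^ 2 = 1 / γ ^ 2 := by rw [hgk]
    linarith
  obtain ⟨gs, hgsK, hrg, hI⟩ := couplingTrajectory_exists_of_topRuns (truncH β K) hγ hM hβ' hcont' hhi htopM K g hg hgM
  have hrgβ : RGEqH K β gs := by
    have h := rgEqH_of_truncH hrg
    rwa [min_self] at h
  have heq : ∀ k, k ≤ K → (C ⟨K, m, gs 0⟩).flow.g k = gs k :=
    flow_eq_of_rgEqH (C ⟨K, m, gs 0⟩).flow β K (fun k hk => hgen.2 ⟨K, m, gs 0⟩ k hk) (hgen.1 ⟨K, m, gs 0⟩) hrgβ (fun k hk => (hI k hk).1)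
  refine ⟨gs 0, fun k hk => ?_, ?_⟩
  · rw [heq k hk]; exact hI k hk
  · rw [heq K le_rfl]; exact hgsK

/-- (Sanity — the uniform case BY the per-level road: Gaps' `endpointExistence_of_topRunsGstar`'s hypotheses imply ours, `perLevelUpper_of_betaUpperH`.)
[cite: Balaban1987RG1, Thm 2 p.259 (first sentence)] -/
theorem endpointExistence_of_topRunsGstar_uniform (hgen : ForwardGenerated C β) {γ₀ β' : ℝ} (hγ₀ : 0 < γ₀) (hcont : BetaContH γ₀ β) (hhi : BetaUpperH β' γ₀ β)
    (htop : ∀ γ : ℝ, 0 < γ → γ ≤ γ₀ → ∃ gstar : ℝ, 0 < gstar ∧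
      ∀ (n : ℕ) (gs : ℕ → ℝ), RGEqH n β gs → Step.InInterval γ n gs → ∀ k, k ≤ n → gs k = γ → gstar ≤ gs n) :
    EndpointExistence C :=
  endpointExistence_of_topRunsGstar_locUpper hgen hγ₀ hcont (perLevelUpper_of_betaUpperH hhi) htop

/-- **★ END FROM FORWARD GENERATION + (C) + PER-LEVEL UPPER BOUNDS + RUN-WISE NO-SHRINK ON A SUB-WINDOW** (`0 ≤ β₀`, `0 < γ′ ≤ γ₀`): the per-level road fed the linear threshold
`g⋆(γ) = γ∕(1+β₀)` on `]0, γ′]` (§1).  NO uniform ceiling, NO sign, NO (PS), NO drift ∕ remainder ∕ jets ∕ anchor.  P3 n°92 §2.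
[cite: Balaban1987RG1, Thm 2 p.259 (first sentence), (0.20) p.256; Balaban1988Convergent, (2.6) p.255] -/
theorem endpointExistence_of_cont_locUpper_noShrink (hgen : ForwardGenerated C β) {γ₀ γ' β₀ : ℝ} (hγ' : 0 < γ') (hγ'le : γ' ≤ γ₀) (hcont : BetaContH γ₀ β)
    (hloc : ∀ k : ℕ, ∃ B : ℝ, ∀ v : Fin (k + 1) → ℝ, v ∈ Box γ₀ k → β k v ≤ B) (hβ₀ : 0 ≤ β₀)
    (hns : ∀ (n : ℕ) (gs : ℕ → ℝ), RGEqH n β gs → Step.InInterval γ' n gs → ∀ m n', m < n' → n' ≤ n → gs m ≤ (1 + β₀) * gs n') :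
    EndpointExistence C :=
  endpointExistence_of_topRunsGstar_locUpper hgen hγ' (fun k => (hcont k).mono (box_mono hγ'le k)) (perLevelUpper_mono hγ'le hloc)
    fun γ hγ hγle => ⟨γ / (1 + β₀), div_pos hγ (by linarith), topRuns_of_noShrink hβ₀ hns γ hγ hγle⟩

/-- **★ THE SAME WITH THE LETTERS ON THE SURVIVOR SETS ∕ RUNS** (the K1 v6 ∕ K2 lane run currency): traces `x ↦ β_k(clampPrefix β γ₀ k x)` continuous on the survivor sets of level `γ₀`
and bounded there PER LEVEL (`∀ k ∃ B_k`), and no-shrink along the in-window runs of a level `γ′ ≤ γ₀` ⟹ END (Gaps' Tietze table `extH F` has the same in-window runs,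
`rgEqH_of_rgEqH_extH`, hence inherits no-shrink; `perLevelUpper_extH`; END transfer `endpointExistence_of_runs`).  P3 n°92 §2.
[cite: Balaban1987RG1, Thm 2 p.259 (first sentence), (0.20) p.256, Thm 3 p.264, §1 pp.263–264; Balaban1988Convergent, (2.6) p.255] -/
theorem endpointExistence_of_survivorLetters_locUpper_noShrink (hgen : ForwardGenerated C β) {γ₀ γ' β₀ : ℝ} (hγ₀ : 0 < γ₀) (hγ' : 0 < γ') (hγ'le : γ' ≤ γ₀)
    (hsc : ∀ k : ℕ, ContinuousOn (fun x : ℝ => β k (clampPrefix β γ₀ k x)) {x : ℝ | 0 < x ∧ x ≤ γ₀ ∧ ∀ j, j ≤ k → 1 / γ₀ ^ 2 ≤ Y β γ₀ j x})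
    (hsl : ∀ k : ℕ, ∃ B : ℝ, ∀ x : ℝ, 0 < x → x ≤ γ₀ → (∀ j, j ≤ k → 1 / γ₀ ^ 2 ≤ Y β γ₀ j x) → β k (clampPrefix β γ₀ k x) ≤ B) (hβ₀ : 0 ≤ β₀)
    (hns : ∀ (n : ℕ) (gs : ℕ → ℝ), RGEqH n β gs → Step.InInterval γ' n gs → ∀ m n', m < n' → n' ≤ n → gs m ≤ (1 + β₀) * gs n') :
    EndpointExistence C := by
  choose B hB using hsl
  obtain ⟨F, hFc, hFu, hagree⟩ := exists_extension_of_survivorLetters (B := B) hsc hB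
  have hns' : ∀ (n : ℕ) (gs : ℕ → ℝ), RGEqH n (extH F) gs → Step.InInterval γ' n gs → ∀ m n', m < n' → n' ≤ n → gs m ≤ (1 + β₀) * gs n' :=
    fun n gs hrg hI m n' hmn hn' => hns n gs (rgEqH_of_rgEqH_extH hγ'le hagree hrg hI) hI m n' hmn hn'
  exact endpointExistence_of_runs hγ₀ (modelOf_forwardGenerated _) (modelOf_haltsOutside _) (modelOf_curries _) hgen
    (fun _ _ hγle _ _ hI hrg => rgEqH_of_rgEqH_extH hγle hagree hrg hI)
    (endpointExistence_of_cont_locUpper_noShrink (modelOf_forwardGenerated (extH F)) hγ' hγ'le (betaContH_extH hFc)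
      (perLevelUpper_extH fun k => ⟨B k, hFu k⟩) hβ₀ hns')

/-- **★★ THE NO-SHRINK TWIN OF K2⁸'s ROAD OF RECORD — ROWS (i) + NO-SHRINK + (C) ⟹ THE END** (any forward-generated `C`): DEF-1's run-wise constant remainder `RunConstRemainder β b r γ₀`
(row (i); `b` ANY sequence — it only supplies the per-level survivor bounds `b_k + r`, `survUpper_of_runConstRemainder`), no-(1+β₀)⁻¹-shrink along the in-window runs of a level
`γ′ ≤ γ₀` (`β₀ ≥ 0`) IN PLACE OF row (iv)'s partial-sum floor, and survivor continuity `SurvCont β γ₀`.  Compare g5's `endpointExistence_of_runConstRemainder_runwisePS_survCont`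
(rows (i)+(iv)+(C)): same (i), same (C), row (iv) ONE RUNG LOWER.  CONDITIONAL on three displayed letters; nothing of Bałaban asserted.  P3 n°92 §2.
[cite: Balaban1987RG1, Thm 2 p.259 (first sentence), Thm 3 p.264, (1.20)–(1.22) p.264, §1 pp.263–264; Balaban1988Convergent, (2.6) p.255] -/
theorem endpointExistence_of_runConstRemainder_noShrink_survCont (hgen : ForwardGenerated C β) {b : ℕ → ℝ} {r γ₀ γ' β₀ : ℝ}
    (hγ₀ : 0 < γ₀) (hrem : RunConstRemainder β b r γ₀) (hγ' : 0 < γ') (hγ'le : γ' ≤ γ₀) (hβ₀ : 0 ≤ β₀)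
    (hns : ∀ (n : ℕ) (gs : ℕ → ℝ), RGEqH n β gs → Step.InInterval γ' n gs → ∀ m n', m < n' → n' ≤ n → gs m ≤ (1 + β₀) * gs n')
    (hsc : SurvCont β γ₀) : EndpointExistence C :=
  endpointExistence_of_survivorLetters_locUpper_noShrink hgen hγ₀ hγ' hγ'le hsc
    (fun k => ⟨b k + r, fun x hx0 hxγ hsurv => survUpper_of_runConstRemainder hγ₀ hrem k x hx0 hxγ hsurv⟩) hβ₀ hns

/-- ONE-LEVEL EDITION (everything at the same level `γ′`: row (i), the no-shrink letter and (C) all read on `]0, γ′]`) — the two-level shape above with `γ₀ := γ′`.  (Conversely the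
two-level shape reduces to this one: rows (i) and (C) restrict from `γ₀` to `γ′ ≤ γ₀` by `K2NamedJetsRunRemAt.RunConstRemainder.mono` and dag-n17-w1's `…N17RunRemAtOfShiftAnchorLevel.survCont_anti`
— ym-nodeO P3 g53's located note (n3) on this port; cited, not imported.) [cite: Balaban1987RG1, Thm 2 p.259 (first sentence), Thm 3 p.264; Balaban1988Convergent, (2.6) p.255] -/
theorem endpointExistence_of_runConstRemainder_noShrink_survCont_oneLevel (hgen : ForwardGenerated C β) {b : ℕ → ℝ} {r γ' β₀ : ℝ}
    (hγ' : 0 < γ') (hrem : RunConstRemainder β b r γ') (hβ₀ : 0 ≤ β₀)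
    (hns : ∀ (n : ℕ) (gs : ℕ → ℝ), RGEqH n β gs → Step.InInterval γ' n gs → ∀ m n', m < n' → n' ≤ n → gs m ≤ (1 + β₀) * gs n')
    (hsc : SurvCont β γ') : EndpointExistence C :=
  endpointExistence_of_runConstRemainder_noShrink_survCont hgen hγ' hrem hγ' le_rfl hβ₀ hns hsc

/-- **THE ROAD OF RECORD FACTORS THROUGH THE RUNG**: rows (i)+(iv)+(C) ⟹ END re-derived as «(iv) ⟹ no-halving on a shrunk level (dag-n24-w1's edge `exists_noShrink_of_psFloor`,
`β₀ := 1`) ⟹ the no-shrink road».  Same letters and conclusion as g5's `endpointExistence_of_runConstRemainder_runwisePS_survCont`; displayed to locate the rung K2⁸'s consumer reads.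
P3 n°92 §2. [cite: Balaban1987RG1, Thm 2 p.259 (first sentence), (5.10) p.293; Balaban1988Convergent, (2.6) p.255] -/
theorem endpointExistence_of_runConstRemainder_runwisePS_survCont_via_noShrink (hgen : ForwardGenerated C β) {b : ℕ → ℝ} {r γ₀ M : ℝ}
    (hγ₀ : 0 < γ₀) (hrem : RunConstRemainder β b r γ₀)
    (hps : ∀ (n : ℕ) (gs : ℕ → ℝ), RGEqH n β gs → Step.InInterval γ₀ n gs → ∀ k, k ≤ n → -M ≤ ∑ j ∈ Finset.Ico k n, β j (prefixOf gs j))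
    (hsc : SurvCont β γ₀) : EndpointExistence C := by
  obtain ⟨γ', hγ', hγ'le, hns⟩ := exists_noShrink_of_psFloor one_pos hγ₀ hps
  exact endpointExistence_of_runConstRemainder_noShrink_survCont hgen hγ₀ hrem hγ' hγ'le zero_le_one hns hsc

/-- (The road of record itself, BY NAME, for comparison: same letters, same conclusion — g5's theorem.) [cite: Balaban1987RG1, Thm 2 p.259 (first sentence)] -/
theorem endpointExistence_of_runConstRemainder_runwisePS_survCont_roadOfRecord (hgen : ForwardGenerated C β) {b : ℕ → ℝ} {r γ₀ M : ℝ}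
    (hγ₀ : 0 < γ₀) (hrem : RunConstRemainder β b r γ₀)
    (hps : ∀ (n : ℕ) (gs : ℕ → ℝ), RGEqH n β gs → Step.InInterval γ₀ n gs → ∀ k, k ≤ n → -M ≤ ∑ j ∈ Finset.Ico k n, β j (prefixOf gs j))
    (hsc : SurvCont β γ₀) : EndpointExistence C :=
  endpointExistence_of_runConstRemainder_runwisePS_survCont hgen hγ₀ hrem hps hsc

end Construction

/-! ## §3 At NODE 00's v1.7 record datum `datumOfRecord₁₃SepCoPH F N θ h` (general `N`) -/

section Datum

variable {F : T4Family} {N : ℕ} [NeZero N]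

/-- **★★ END AT THE RECORD DATUM FROM ROWS (i) + NO-SHRINK + (C) OF THE β OF RECORD** (`betaOfRecord₁₃ F N θ.toStage13Params`, which IS the datum's β,
`Node00.βfun_datumOfRecord₁₃SepCoPH`, `rfl`; forward generation is the datum's FIELD `fwd`).  The no-shrink twin of g5's `endpointExistence_datumOfRecord₁₃SepCoPH_of_runRows_survCont`.
CONDITIONAL; no item closed.  P3 n°92 §3.
[cite: Balaban1987RG1, Thm 2 p.259 (first sentence), Thm 3 p.264, (1.20)–(1.22) p.264, §1 pp.263–264; Balaban1988Convergent, (2.6) p.255; Balaban1989LargeFieldII, Thm 1 + (0.1) pp.355–356] -/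
theorem endpointExistence_datumOfRecord₁₃SepCoPH_of_runConstRemainder_noShrink_survCont (θ : Node00.Stage13HParams F N) (h : θ.Provisos₁₃SepCoPH F N)
    {b : ℕ → ℝ} {r γ₀ γ' β₀ : ℝ} (hγ₀ : 0 < γ₀) (hrem : RunConstRemainder (Node00.betaOfRecord₁₃ F N θ.toStage13Params) b r γ₀) (hγ' : 0 < γ') (hγ'le : γ' ≤ γ₀) (hβ₀ : 0 ≤ β₀)
    (hns : ∀ (n : ℕ) (gs : ℕ → ℝ), RGEqH n (Node00.betaOfRecord₁₃ F N θ.toStage13Params) gs → Step.InInterval γ' n gs →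
      ∀ m n', m < n' → n' ≤ n → gs m ≤ (1 + β₀) * gs n')
    (hsc : SurvCont (Node00.betaOfRecord₁₃ F N θ.toStage13Params) γ₀) :
    EndpointExistence (Node00.datumOfRecord₁₃SepCoPH F N θ h).C.toB12 :=
  endpointExistence_of_runConstRemainder_noShrink_survCont (Node00.datumOfRecord₁₃SepCoPH F N θ h).fwd hγ₀ hrem hγ' hγ'le hβ₀ hns hsc

/-- … box edition (K2⁷ LINE 2's S3 shape `BetaContH` + a two-sided box, NO remainder letter, NO (PS)): box bounds give row (i) about the midpoint (n24-w1's `runConstRemainder_of_boxBounds`),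
box continuity gives (C) (Gaps' `survCont_of_betaContH`).  P3 n°92 §3. [cite: Balaban1987RG1, Thm 2 p.259 (first sentence), §1 (1.22) p.264, §1 pp.263–264; Balaban1988Convergent, (2.6) p.255] -/
theorem endpointExistence_datumOfRecord₁₃SepCoPH_of_box_cont_noShrink (θ : Node00.Stage13HParams F N) (h : θ.Provisos₁₃SepCoPH F N)
    {lo hi γ₀ γ' β₀ : ℝ} (hγ₀ : 0 < γ₀) (hlo : BetaLowerH lo γ₀ (Node00.betaOfRecord₁₃ F N θ.toStage13Params)) (hhi : BetaUpperH hi γ₀ (Node00.betaOfRecord₁₃ F N θ.toStage13Params))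
    (hcont : BetaContH γ₀ (Node00.betaOfRecord₁₃ F N θ.toStage13Params)) (hγ' : 0 < γ') (hγ'le : γ' ≤ γ₀) (hβ₀ : 0 ≤ β₀)
    (hns : ∀ (n : ℕ) (gs : ℕ → ℝ), RGEqH n (Node00.betaOfRecord₁₃ F N θ.toStage13Params) gs → Step.InInterval γ' n gs →
      ∀ m n', m < n' → n' ≤ n → gs m ≤ (1 + β₀) * gs n') :
    EndpointExistence (Node00.datumOfRecord₁₃SepCoPH F N θ h).C.toB12 :=
  endpointExistence_datumOfRecord₁₃SepCoPH_of_runConstRemainder_noShrink_survCont θ h hγ₀ (runConstRemainder_of_boxBounds hlo hhi) hγ' hγ'le hβ₀ hns (survCont_of_betaContH hγ₀ hcont)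

end Datum

/-! ## §4 `N = 2`: K2⁸'s shape with the rows conjunct's row (iv) ONE RUNG LOWER holds outright (texts INLINE; the by-name concluder a no-shrink-keyed rows display would read) -/

section InlineConcluder

/-- **★ K2⁸'s SHAPE IN THE NO-SHRINK CURRENCY HOLDS OUTRIGHT** (texts inline; `N = 2`): at every Stage-13 tuple `θ` with provisos `h` — unity ∧ slots, admissibility, (B) at the datum and the
window being UNREAD, exactly as in K2⁸'s closer — the rows conjunct «∃ b r γ₀ γ′ β₀, 0 < γ′ ≤ γ₀ ∧ 0 ≤ β₀ ∧ (i) `RunConstRemainder β_θ b r γ₀` ∧ no-(1+β₀)⁻¹-shrink on `]0, γ′]` ∧ (C) `SurvCont β_θ γ₀`»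
gives `EndpointExistence (datum).C.toB12` (§3).  P3 n°92's `k2R8NS_holds` with the texts inlined over tree predicates.  CONDITIONAL on the displayed rows; no item closed.
[cite: Balaban1987RG1, Thm 2 p.259 (first sentence), Thm 3 p.264; Balaban1988Convergent, (2.6) p.255] -/
theorem endpointExistence_datumOfRecord₁₃SepCoPH_of_runRowsNoShrink :
    ∀ (F : T4Family) (θ : Node00.Stage13HParams F 2) (h : θ.Provisos₁₃SepCoPH F 2), (θ.ZhUnity F 2 ∧ θ.SlotsNondegenerate₁₃ F 2) → θ.Admissible F 2 →
      B16.EndStatementBPrinted (Node00.datumOfRecord₁₃SepCoPH F 2 θ h).C →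
      (∃ (b : ℕ → ℝ) (r γ₀ γ' β₀ : ℝ), 0 < γ' ∧ γ' ≤ γ₀ ∧ 0 ≤ β₀ ∧ RunConstRemainder (Node00.betaOfRecord₁₃ F 2 θ.toStage13Params) b r γ₀ ∧
        (∀ (n : ℕ) (gs : ℕ → ℝ), RGEqH n (Node00.betaOfRecord₁₃ F 2 θ.toStage13Params) gs → Step.InInterval γ' n gs →
          ∀ m n', m < n' → n' ≤ n → gs m ≤ (1 + β₀) * gs n') ∧
        SurvCont (Node00.betaOfRecord₁₃ F 2 θ.toStage13Params) γ₀) →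
      Window (Node00.datumOfRecord₁₃SepCoPH F 2 θ h) →
      EndpointExistence (Node00.datumOfRecord₁₃SepCoPH F 2 θ h).C.toB12 := by
  intro F θ h _hU _hθ _hB hrows _hwin
  obtain ⟨b, r, γ₀, γ', β₀, hγ', hγ'le, hβ₀, hrem, hns, hsc⟩ := hrows
  exact endpointExistence_datumOfRecord₁₃SepCoPH_of_runConstRemainder_noShrink_survCont θ h (hγ'.trans_le hγ'le) hrem hγ' hγ'le hβ₀ hns hsc

/-- **THE PRESSED ROWS CONJUNCT ⟹ THE NO-SHRINK ROWS CONJUNCT** (texts inline; row (iv) ⟹ no-halving on a shrunk level by dag-n24-w1's edge, `β₀ := 1`; rows (i) and (C) untouched at level `γ₀`):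
so every supplier of K1 v6 stub 2″'s ∕ K1⁸'s rows (i)+(iv)+(C) at a tuple also supplies §4's antecedent.  P3 n°92's `runRowsNoShrink13_of_runRowsCont13`, inlined.
[cite: Balaban1988Convergent, (2.6) p.255; Balaban1987RG1, (0.20) p.256, (5.10) p.293] -/
theorem runRowsNoShrink_of_runRowsPS {F : T4Family} {θ : Node00.Stage13HParams F 2}
    (hrows : ∃ (b : ℕ → ℝ) (r γ₀ M : ℝ), 0 < γ₀ ∧ RunConstRemainder (Node00.betaOfRecord₁₃ F 2 θ.toStage13Params) b r γ₀ ∧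
      (∀ (n : ℕ) (gs : ℕ → ℝ), RGEqH n (Node00.betaOfRecord₁₃ F 2 θ.toStage13Params) gs → Step.InInterval γ₀ n gs →
        ∀ k, k ≤ n → -M ≤ ∑ j ∈ Finset.Ico k n, Node00.betaOfRecord₁₃ F 2 θ.toStage13Params j (prefixOf gs j)) ∧
      SurvCont (Node00.betaOfRecord₁₃ F 2 θ.toStage13Params) γ₀) :
    ∃ (b : ℕ → ℝ) (r γ₀ γ' β₀ : ℝ), 0 < γ' ∧ γ' ≤ γ₀ ∧ 0 ≤ β₀ ∧ RunConstRemainder (Node00.betaOfRecord₁₃ F 2 θ.toStage13Params) b r γ₀ ∧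
      (∀ (n : ℕ) (gs : ℕ → ℝ), RGEqH n (Node00.betaOfRecord₁₃ F 2 θ.toStage13Params) gs → Step.InInterval γ' n gs →
        ∀ m n', m < n' → n' ≤ n → gs m ≤ (1 + β₀) * gs n') ∧
      SurvCont (Node00.betaOfRecord₁₃ F 2 θ.toStage13Params) γ₀ := by
  obtain ⟨b, r, γ₀, M, hγ₀, hrem, hps, hsc⟩ := hrows
  obtain ⟨γ', hγ', hγ'le, hns⟩ := exists_noShrink_of_psFloor one_pos hγ₀ hps
  exact ⟨b, r, γ₀, γ', 1, hγ', hγ'le, zero_le_one, hrem, hns, hsc⟩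

end InlineConcluder

end Summit.QuantumFields.YangMills.Theorems.BalabanUVNodesK1EndOfRunRowsNoShrinkSurvCont

end
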